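import Mathlib

/-!
# Uniqueness of positive solutions of the discrete Thomas–Fermi-class Gross–Pitaevskii equation

Discrete kernel of step R4b of the steady zeroth-law programme (solo-blind paper §24.17(7)(e),(h)).
At finite `n` the reduced steady pattern equation for the envelope `A > 0` of the columnar rolls is,
in scaled variables, the nonlocal Gross–Pitaevskii equation

  `ε² A'' + b A − A · T[A²] = 0`,   `b = 1 − s²` (leafwise supercriticality),

with `T = ∂³ S_w` the resolvent-smoothed third derivative.  In the Thomas–Fermi class `T` is
MONOTONE (positive semi-definite symmetric part, kernel = constants) but not symmetric, so the
equation is not variational.  Nevertheless positive solutions are unique.  The mechanism is the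
convexity of the kinetic energy in the density `ρ = A²` (the quantum pressure `−ε²ΔA/A` is a
monotone function of `ρ`), which on a graph reduces to the edge identity

  `(a² − c²)(d/c − b/a) + (b² − d²)(c/d − a/b) = (ab + cd)(ad − bc)² / (abcd) ≥ 0`.

We prove the identity, the monotonicity of the discrete quantum pressure on the cycle `ZMod N`, and
the uniqueness theorem: two positive solutions coincide unless they are constant states proportional
to each other.  Finite-dimensional algebra only.
-/

namespace Summit.AnomalousDissipation.AnomalousDissipation.Theorems

open Matrix Finset

/-- The edge term of the monotonicity form of the discrete quantum pressure. -/
noncomputable def gpEdge (a b c d : ℝ) : ℝ := (a ^ 2 - c ^ 2) * (d / c - b / a) + (b ^ 2 - d ^ 2) * (c / d - a / b)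

/-- **Edge identity**: the edge term is an explicit sum of squares over `abcd`. -/
theorem gpEdge_eq (a b c d : ℝ) (ha : a ≠ 0) (hb : b ≠ 0) (hc : c ≠ 0) (hd : d ≠ 0) :
    gpEdge a b c d = (a * b + c * d) * (a * d - b * c) ^ 2 / (a * b * c * d) := by
  unfold gpEdge
  field_simp
  ring

/-- The edge term is nonnegative for positive arguments (convexity of `(√ρᵢ − √ρⱼ)²` in `ρ`). -/
theorem gpEdge_nonneg (a b c d : ℝ) (ha : 0 < a) (hb : 0 < b) (hc : 0 < c) (hd : 0 < d) :
    0 ≤ gpEdge a b c d := by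
  rw [gpEdge_eq a b c d ha.ne' hb.ne' hc.ne' hd.ne']
  positivity

/-- The edge term vanishes iff `a d = b c` (the two positive profiles have the same ratio across the edge). -/
theorem gpEdge_eq_zero_iff (a b c d : ℝ) (ha : 0 < a) (hb : 0 < b) (hc : 0 < c) (hd : 0 < d) :
    gpEdge a b c d = 0 ↔ a * d = b * c := by
  rw [gpEdge_eq a b c d ha.ne' hb.ne' hc.ne' hd.ne']
  have hden : a * b * c * d ≠ 0 := by positivity
  have hsum : a * b + c * d ≠ 0 := by positivity
  constructor
  · intro h
    rcases div_eq_zero_iff.mp h with h | h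
    · rcases mul_eq_zero.mp h with h | h
      · exact absurd h hsum
      · have := pow_eq_zero_iff (n := 2) (by norm_num) |>.mp h
        linarith
    · exact absurd h hden
  · intro h
    have : a * d - b * c = 0 := by linarith
    rw [this]; simp

/-- Discrete second difference on the cycle `ZMod N`. -/
def lapZ {N : ℕ} (A : ZMod N → ℝ) (i : ZMod N) : ℝ := A (i + 1) - 2 * A i + A (i - 1)

/-- A function on `ZMod N` that is invariant under `i ↦ i + 1` is constant. -/
lemma const_of_succ_eq {N : ℕ} [NeZero N] (r : ZMod N → ℝ) (h : ∀ i, r (i + 1) = r i) :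
    ∀ i, r i = r 0 := by
  intro i
  obtain ⟨n, rfl⟩ := ZMod.natCast_zmod_surjective i
  induction n with
  | zero => simp
  | succ n ih =>
    have := h (n : ZMod N)
    push_cast
    rw [this, ih]

/-- **Monotonicity of the discrete quantum pressure.** For positive `A₁, A₂` on the cycle,
`∑ᵢ (A₁ᵢ² − A₂ᵢ²)·(−ΔA₁ᵢ/A₁ᵢ + ΔA₂ᵢ/A₂ᵢ) = ∑ᵢ gpEdge(A₁ᵢ, A₁ᵢ₊₁, A₂ᵢ, A₂ᵢ₊₁) ≥ 0`. -/
theorem quantumPressure_form_eq {N : ℕ} [NeZero N] (A₁ A₂ : ZMod N → ℝ)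
    (h₁ : ∀ i, 0 < A₁ i) (h₂ : ∀ i, 0 < A₂ i) :
    ∑ i, (A₁ i ^ 2 - A₂ i ^ 2) * (-(lapZ A₁ i) / A₁ i + lapZ A₂ i / A₂ i)
      = ∑ i, gpEdge (A₁ i) (A₁ (i + 1)) (A₂ i) (A₂ (i + 1)) := by
  -- split each node term into a forward-edge part f i and a backward-edge part g (i - 1)
  set f : ZMod N → ℝ := fun i => (A₁ i ^ 2 - A₂ i ^ 2) * (A₂ (i + 1) / A₂ i - A₁ (i + 1) / A₁ i) with hf
  set g : ZMod N → ℝ := fun i => (A₁ (i + 1) ^ 2 - A₂ (i + 1) ^ 2) * (A₂ i / A₂ (i + 1) - A₁ i / A₁ (i + 1))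
    with hg
  have hterm : ∀ i, (A₁ i ^ 2 - A₂ i ^ 2) * (-(lapZ A₁ i) / A₁ i + lapZ A₂ i / A₂ i) = f i + g (i - 1) := by
    intro i
    simp only [hf, hg, lapZ, sub_add_cancel]
    have ha := (h₁ i).ne'; have hc := (h₂ i).ne'
    field_simp
    ring
  have hedge : ∀ i, gpEdge (A₁ i) (A₁ (i + 1)) (A₂ i) (A₂ (i + 1)) = f i + g i := by
    intro i; simp only [hf, hg, gpEdge]
  rw [Finset.sum_congr rfl (fun i _ => hterm i), Finset.sum_congr rfl (fun i _ => hedge i),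
    Finset.sum_add_distrib, Finset.sum_add_distrib]
  congr 1
  -- reindex the backward parts: ∑ g (i - 1) = ∑ g i
  exact Fintype.sum_equiv (Equiv.subRight (1 : ZMod N)) _ _ (fun i => rfl)

/-- The quantum-pressure monotonicity form is nonnegative (discrete convexity of the kinetic energy in the density). -/
theorem quantumPressure_form_nonneg {N : ℕ} [NeZero N] (A₁ A₂ : ZMod N → ℝ)
    (h₁ : ∀ i, 0 < A₁ i) (h₂ : ∀ i, 0 < A₂ i) :
    0 ≤ ∑ i, (A₁ i ^ 2 - A₂ i ^ 2) * (-(lapZ A₁ i) / A₁ i + lapZ A₂ i / A₂ i) := by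
  rw [quantumPressure_form_eq A₁ A₂ h₁ h₂]
  exact Finset.sum_nonneg fun i _ => gpEdge_nonneg _ _ _ _ (h₁ i) (h₁ _) (h₂ i) (h₂ _)

/-- A positive solution of the discrete GP equation `ε² ΔA + b A − A·T[A²] = 0` on the cycle. -/
structure IsGPSolution {N : ℕ} [NeZero N] (T : Matrix (ZMod N) (ZMod N) ℝ) (b : ZMod N → ℝ) (ε : ℝ)
    (A : ZMod N → ℝ) : Prop where
  pos : ∀ i, 0 < A i
  eqn : ∀ i, ε ^ 2 * lapZ A i + b i * A i - A i * (T *ᵥ (fun j => A j ^ 2)) i = 0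

/-- The interaction form of the density difference of two positive GP solutions equals `−ε²` times
the (nonnegative) quantum-pressure form. -/
theorem gp_density_form_eq {N : ℕ} [NeZero N] (T : Matrix (ZMod N) (ZMod N) ℝ) (b : ZMod N → ℝ)
    (ε : ℝ) (A₁ A₂ : ZMod N → ℝ) (h₁ : IsGPSolution T b ε A₁) (h₂ : IsGPSolution T b ε A₂) :
    ((fun i => A₁ i ^ 2) - fun i => A₂ i ^ 2) ⬝ᵥ (T *ᵥ ((fun i => A₁ i ^ 2) - fun i => A₂ i ^ 2))
      = -ε ^ 2 * ∑ i, (A₁ i ^ 2 - A₂ i ^ 2) * (-(lapZ A₁ i) / A₁ i + lapZ A₂ i / A₂ i) := by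
  rw [Matrix.mulVec_sub, Finset.mul_sum]
  unfold dotProduct
  refine Finset.sum_congr rfl fun i _ => ?_
  have ha := (h₁.pos i).ne'; have hc := (h₂.pos i).ne'
  have e₁ : (T *ᵥ fun j => A₁ j ^ 2) i = ε ^ 2 * lapZ A₁ i / A₁ i + b i := by
    have h := h₁.eqn i
    field_simp
    linarith [h]
  have e₂ : (T *ᵥ fun j => A₂ j ^ 2) i = ε ^ 2 * lapZ A₂ i / A₂ i + b i := by
    have h := h₂.eqn i
    field_simp
    linarith [h]
  simp only [Pi.sub_apply, e₁, e₂]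
  field_simp
  ring

/-- **Uniqueness of the positive pattern (discrete R4b).**  Let `T` be monotone with quadratic form
vanishing only on constants (Thomas–Fermi class) and `ε ≠ 0`.  Two positive solutions of the
discrete GP equation on the cycle coincide, unless they are constant states proportional to each
other (the degenerate case, absent under confinement `b = 1 − s²`). -/
theorem gp_positive_solution_unique {N : ℕ} [NeZero N] (T : Matrix (ZMod N) (ZMod N) ℝ)
    (b : ZMod N → ℝ) (ε : ℝ) (hε : ε ≠ 0)
    (hpsd : ∀ v : ZMod N → ℝ, 0 ≤ v ⬝ᵥ (T *ᵥ v))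
    (hker : ∀ v : ZMod N → ℝ, v ⬝ᵥ (T *ᵥ v) = 0 → ∃ c : ℝ, ∀ i, v i = c)
    (A₁ A₂ : ZMod N → ℝ) (h₁ : IsGPSolution T b ε A₁) (h₂ : IsGPSolution T b ε A₂) :
    A₁ = A₂ ∨ ∃ κ : ℝ, (∀ i, A₁ i = κ * A₂ i) ∧ ∀ i, A₂ i = A₂ 0 := by
  set S := ∑ i, (A₁ i ^ 2 - A₂ i ^ 2) * (-(lapZ A₁ i) / A₁ i + lapZ A₂ i / A₂ i) with hS
  have hSnn : 0 ≤ S := quantumPressure_form_nonneg A₁ A₂ h₁.pos h₂.pos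
  have hform := gp_density_form_eq T b ε A₁ A₂ h₁ h₂
  have hε2 : 0 < ε ^ 2 := by positivity
  -- monotonicity of T and of the quantum pressure force both forms to vanish
  have hF0 : ((fun i => A₁ i ^ 2) - fun i => A₂ i ^ 2) ⬝ᵥ (T *ᵥ ((fun i => A₁ i ^ 2) - fun i => A₂ i ^ 2)) = 0 := by
    have := hpsd ((fun i => A₁ i ^ 2) - fun i => A₂ i ^ 2)
    nlinarith
  have hS0 : S = 0 := by nlinarith
  -- (i) densities differ by a constant
  obtain ⟨m, hm⟩ := hker _ hF0
  -- (ii) every edge term vanishes: the ratio A₁/A₂ is constant around the cycle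
  have hedges : ∀ i, gpEdge (A₁ i) (A₁ (i + 1)) (A₂ i) (A₂ (i + 1)) = 0 := by
    have hsum : ∑ i, gpEdge (A₁ i) (A₁ (i + 1)) (A₂ i) (A₂ (i + 1)) = 0 := by
      rw [← quantumPressure_form_eq A₁ A₂ h₁.pos h₂.pos]; exact hS0
    intro i
    exact (Finset.sum_eq_zero_iff_of_nonneg (fun j _ =>
      gpEdge_nonneg _ _ _ _ (h₁.pos j) (h₁.pos _) (h₂.pos j) (h₂.pos _))).mp hsum i (Finset.mem_univ i)
  have hratio : ∀ i, A₁ i / A₂ i = A₁ 0 / A₂ 0 := by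
    apply const_of_succ_eq
    intro i
    have h := (gpEdge_eq_zero_iff _ _ _ _ (h₁.pos i) (h₁.pos _) (h₂.pos i) (h₂.pos _)).mp (hedges i)
    have hc := (h₂.pos i).ne'; have hd := (h₂.pos (i + 1)).ne'
    rw [div_eq_div_iff hd hc]
    linarith
  set κ := A₁ 0 / A₂ 0 with hκ
  have hA : ∀ i, A₁ i = κ * A₂ i := by
    intro i
    have := hratio i
    have hc := (h₂.pos i).ne'
    rw [div_eq_iff hc] at this
    exact this
  -- (iii) combine: (κ² − 1) ρ₂ is constant
  by_cases hk : κ ^ 2 = 1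
  · left
    have hκpos : 0 < κ := by rw [hκ]; exact div_pos (h₁.pos 0) (h₂.pos 0)
    have hκ1 : κ = 1 := by nlinarith
    funext i; rw [hA i, hκ1, one_mul]
  · right
    refine ⟨κ, hA, fun i => ?_⟩
    have hi := hm i; have h0 := hm 0
    simp only [Pi.sub_apply, hA] at hi h0
    -- (κ²-1) A₂ i² = m = (κ²-1) A₂ 0²  ⇒ A₂ i² = A₂ 0² ⇒ A₂ i = A₂ 0 (both positive)
    have hsq : A₂ i ^ 2 = A₂ 0 ^ 2 := by
      have hk' : κ ^ 2 - 1 ≠ 0 := sub_ne_zero.mpr hk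
      apply mul_left_cancel₀ hk'
      nlinarith
    have := (h₂.pos i); have := (h₂.pos 0)
    nlinarith
end Summit.AnomalousDissipation.AnomalousDissipation.Theorems
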